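import Literature.Analysis.FluidPDE.AncientMildWeakStar
import Literature.Analysis.FluidPDE.KNSSLiouvilleBridge
import Literature.Analysis.FunctionSpaces.Mollification
import Mathlib.MeasureTheory.Constructions.Polish.StronglyMeasurable
import HarnessLib

/-!
# Jointly measurable modifications, and KNSS's Theorem 5.3 implies the duality-form fact

Analysis/FluidPDE support file (all results proved) for the named fact
`Literature.Analysis.FluidPDE.knss_bound_C_over_r` (`SelfSimilarLiouville`; Koch–Nadirashvili–
Seregin–Šverák 2009, Theorem 5.3). It closes the bridge from the theorem **as printed** — for
bounded weak solutions `u ∈ L^∞(ℝ³ × (-∞, 0))`, the named fact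
`Literature.Analysis.FluidPDE.KNSS2009_liouville_bound_C_over_r` of `KNSSLiouville` — to the
tree's rendering in the duality-form class of bounded ancient mild solutions:

* `Literature.Analysis.FluidPDE.knss_bound_C_over_r_of_KNSS2009 :
    KNSS2009_liouville_bound_C_over_r → knss_bound_C_over_r` (**proved**).

So the duality-form fact is now exactly as strong as the printed theorem, whose discharge
(KNSS 2009, §4 regularity of bounded weak solutions, Lemma 2.1, Theorem 5.2 and the cut-off
argument of p. 10) is what remains for `knss_bound_C_over_r_holds`.

## Contents

The missing piece after `KNSSLiouvilleBridge` (`knss_bound_C_over_r_of_KNSS2009_of_modification`)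
was measure theoretic: the duality-form class quantifies over families `u : ℝ → ℝ³ → ℝ³` with
measurable *slices*, and the printed class needs a jointly measurable representative.

* `continuousOn_convolution_normed` (any dimension): for a bounded family with measurable
  slices which is weak-* continuous in time (`t ↦ ∫⟪u(t), θ⟫` continuous for every test field
  `θ`), the spatial mollification `(t, x) ↦ (ρ ⋆ u(t))(x)` is jointly continuous on
  `(-∞, 0) × E`: its components are pairings with the test fields `ρ(x - ·)bᵢ`, which move
  continuously in `L¹` (`tendsto_integral_abs_normed_sub`), and `∫⟪u(t), ·⟫` is `M`-Lipschitz on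
  `L¹` uniformly in `t`.
* `exists_stronglyMeasurable_modification` (any dimension): such a family has a jointly
  (strongly) measurable modification `w` with `w(t) = u(t)` a.e. for **every** `t < 0` — the
  pointwise limit (`limUnder`, measurable by `MeasureTheory.StronglyMeasurable.limUnder`) of the
  mollifications along a mollifier sequence, which converge a.e. on every slice (Lebesgue
  differentiation, `Literature.Analysis.FunctionSpaces.ae_tendsto_normed_convolution`).
* `knss_bound_C_over_r_of_KNSS2009`: for `u` in the hypotheses of the fact, the pairings with
  divergence-free tests are continuous in time (`AncientMildPairing`) and the decay
  `r‖u‖ ≤ C` upgrades this to weak-* continuity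
  (`AncientMildWeakStar.continuousOn_integral_inner_of_cylRadius_decay`), whence the
  modification, and `KNSSLiouvilleBridge` concludes.

## References

* G. Koch, N. Nadirashvili, G. Seregin, V. Šverák, *Liouville theorems for the Navier–Stokes
  equations and applications*, Acta Math. 203 (2009) 83–105 = arXiv:0709.3599, Theorem 5.3
  p. 10, §1 p. 3, §4 (i)–(ii) p. 8. [KochNadirashviliSereginSverak2009]
* L. C. Evans, *Partial Differential Equations*, 2nd ed. (AMS 2010), App. C.4, Thm. 7
  (mollifiers). [Evans2010]
-/

noncomputable section

open MeasureTheory Set Function Filter Topology TopologicalSpace InnerProductSpace ContinuousLinearMap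
open scoped RealInnerProductSpace NNReal ENNReal ContDiff Convolution

namespace Literature.Analysis.FluidPDE

variable {E : Type*} [NormedAddCommGroup E] [InnerProductSpace ℝ E] [FiniteDimensional ℝ E]
  [MeasurableSpace E] [BorelSpace E]

/-! ### Mollification in space of a weak-* continuous family is jointly continuous -/

section Mollify

variable {u : ℝ → E → E} {M : ℝ}

/-- **`L¹`-continuity of the translates of a bump**: `x ↦ ∫ |ρ(x - z) - ρ(x₀ - z)| dz` is
continuous at `x₀` with value `0` (dominated convergence: near `x₀` the integrand is bounded by
`2 sup|ρ|` on a fixed ball and vanishes off it). [folklore] -/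
theorem tendsto_integral_abs_normed_sub (ρ : ContDiffBump (0 : E)) (x₀ : E) :
    Tendsto (fun x => ∫ z, |ρ.normed volume (x - z) - ρ.normed volume (x₀ - z)|) (𝓝 x₀) (𝓝 0) := by
  set f : E → ℝ := ρ.normed volume with hf_def
  have hfc : Continuous f := ρ.continuous_normed
  obtain ⟨Cf, hCf⟩ := hfc.bounded_above_of_compact_support ρ.hasCompactSupport_normed
  have hsupp : ∀ y, ρ.rOut ≤ ‖y‖ → f y = 0 := fun y hy => by
    have h : y ∉ Function.support f := by
      rw [hf_def, ContDiffBump.support_normed_eq, Metric.mem_ball, dist_zero_right, not_lt]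
      exact hy
    simpa [Function.mem_support] using h
  have h0 : (∫ z, |f (x₀ - z) - f (x₀ - z)|) = 0 := by simp
  rw [← h0]
  refine (continuousAt_of_dominated (bound := fun z =>
    (Metric.closedBall x₀ (ρ.rOut + 1)).indicator (fun _ => 2 * Cf) z) ?_ ?_ ?_ ?_).tendsto
  · exact Eventually.of_forall fun x =>
      ((hfc.comp (continuous_const.sub continuous_id)).sub
        (hfc.comp (continuous_const.sub continuous_id))).abs.aestronglyMeasurable
  · filter_upwards [Metric.ball_mem_nhds x₀ one_pos] with x hx
    refine Eventually.of_forall fun z => ?_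
    by_cases hz : z ∈ Metric.closedBall x₀ (ρ.rOut + 1)
    · rw [indicator_of_mem hz, Real.norm_eq_abs, abs_abs]
      calc |f (x - z) - f (x₀ - z)| ≤ |f (x - z)| + |f (x₀ - z)| := abs_sub _ _
        _ ≤ Cf + Cf := add_le_add (by simpa using hCf (x - z)) (by simpa using hCf (x₀ - z))
        _ = 2 * Cf := by ring
    · rw [indicator_of_notMem hz]
      rw [Metric.mem_closedBall, not_le, dist_comm] at hz
      have hx' : dist x x₀ < 1 := Metric.mem_ball.1 hx
      have h1 : f (x - z) = 0 := hsupp _ (by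
        have := dist_triangle x₀ x z
        rw [dist_comm x₀ x, dist_eq_norm x z] at this
        linarith)
      have h2 : f (x₀ - z) = 0 := hsupp _ (by rw [← dist_eq_norm]; linarith)
      simp [h1, h2]
  · refine (integrable_indicator_iff Metric.isClosed_closedBall.measurableSet).2 ?_
    haveI : IsFiniteMeasure (volume.restrict (Metric.closedBall x₀ (ρ.rOut + 1))) :=
      isFiniteMeasure_restrict.2 (isCompact_closedBall _ _).measure_lt_top.ne
    exact integrable_const _
  · exact Eventually.of_forall fun z =>
      (((hfc.comp (continuous_id.sub continuous_const)).sub continuous_const).abs).continuousAt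

/-- **Components of a mollification are pairings**: for a bounded measurable field `w` and a
bump `ρ`, `(ρ ⋆ w)(x) = Σᵢ (∫⟪w, ρ(x - ·) bᵢ⟫) bᵢ` over an orthonormal frame. [folklore] -/
theorem convolution_normed_eq_sum_integral_inner (ρ : ContDiffBump (0 : E)) {w : E → E} {M : ℝ}
    (hw : AEStronglyMeasurable w volume) (hM : ∀ x, ‖w x‖ ≤ M) (x : E) :
    (ρ.normed volume ⋆[lsmul ℝ ℝ, volume] w) x =
      ∑ i, (∫ z, ⟪w z, ρ.normed volume (x - z) • stdOrthonormalBasis ℝ E i⟫) •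
        stdOrthonormalBasis ℝ E i := by
  set b := stdOrthonormalBasis ℝ E
  set f : E → ℝ := ρ.normed volume with hf_def
  have hf : FunctionSpaces.IsTestFunctionOn (⊤ : Opens E) f := FunctionSpaces.isTestFunctionOn_normed ρ
  have hconv : (f ⋆[lsmul ℝ ℝ, volume] w) x = ∫ z, f (x - z) • w z := by
    rw [convolution_eq_swap]
    simp only [lsmul_apply]
  have hfx := hf.comp_sub_left x
  have hfxi : Integrable (fun z => f (x - z)) volume :=
    hfx.contDiff.continuous.integrable_of_hasCompactSupport hfx.hasCompactSupport
  have hint : Integrable (fun z => f (x - z) • w z) volume := by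
    refine Integrable.mono' (hfxi.norm.mul_const M)
      ((hfx.contDiff.continuous.aestronglyMeasurable).smul hw) (Eventually.of_forall fun z => ?_)
    rw [norm_smul]
    exact mul_le_mul_of_nonneg_left (hM z) (norm_nonneg _)
  rw [hconv, ← b.sum_repr' (∫ z, f (x - z) • w z)]
  refine Finset.sum_congr rfl fun i _ => ?_
  congr 1
  rw [← integral_inner hint (b i)]
  refine integral_congr_ae (Eventually.of_forall fun z => ?_)
  show ⟪b i, f (x - z) • w z⟫ = ⟪w z, f (x - z) • b i⟫
  rw [real_inner_smul_right, real_inner_smul_right, real_inner_comm]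

/-- **Joint continuity of one pairing component.** Under the hypotheses of
`continuousOn_convolution_normed`, `(t, x) ↦ ∫⟪u(t), ρ(x - ·) c⟫` is continuous on
`(-∞, 0) × E` for every vector `c`. [folklore] -/
theorem continuousOn_integral_inner_normed_smul (ρ : ContDiffBump (0 : E))
    (hM : ∀ t < 0, ∀ x, ‖u t x‖ ≤ M) (hmeas : ∀ t < 0, AEStronglyMeasurable (u t) volume)
    (hws : ∀ θ : E → E, FunctionSpaces.IsTestFunctionOn (⊤ : Opens E) θ →
      ContinuousOn (fun t => ∫ x, ⟪u t x, θ x⟫) (Iio 0)) (c : E) :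
    ContinuousOn (fun p : ℝ × E => ∫ z, ⟪u p.1 z, ρ.normed volume (p.2 - z) • c⟫)
      (Iio 0 ×ˢ univ) := by
  have hf : FunctionSpaces.IsTestFunctionOn (⊤ : Opens E) (ρ.normed volume) :=
    FunctionSpaces.isTestFunctionOn_normed ρ
  have hfc : Continuous (ρ.normed volume) := ρ.continuous_normed
  have hM0 : 0 ≤ M := (norm_nonneg _).trans (hM (-1) (by norm_num) 0)
  -- the test fields `ψ x = ρ(x - ·) c`
  have hψ : ∀ x, FunctionSpaces.IsTestFunctionOn (⊤ : Opens E) (fun z => ρ.normed volume (x - z) • c) :=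
    fun x => ⟨(hf.comp_sub_left x).contDiff.smul contDiff_const,
      (hf.comp_sub_left x).hasCompactSupport.smul_right, by simp⟩
  have hψi : ∀ x, Integrable (fun z => ρ.normed volume (x - z) • c) volume := fun x =>
    (hψ x).contDiff.continuous.integrable_of_hasCompactSupport (hψ x).hasCompactSupport
  have hfxi : ∀ x, Integrable (fun z => ρ.normed volume (x - z)) volume := fun x =>
    (hfc.comp (continuous_const.sub continuous_id)).integrable_of_hasCompactSupport
      (hf.comp_sub_left x).hasCompactSupport
  intro p₀ hp₀
  have ht₀ : p₀.1 < 0 := (mem_prod.1 hp₀).1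
  -- `L¹` modulus of `x ↦ ψ x` at `p₀.2`
  have hF : Tendsto (fun x => ∫ z, |ρ.normed volume (x - z) - ρ.normed volume (p₀.2 - z)|)
      (𝓝 p₀.2) (𝓝 0) := tendsto_integral_abs_normed_sub ρ p₀.2
  have hg : ContinuousOn (fun t => ∫ z, ⟪u t z, ρ.normed volume (p₀.2 - z) • c⟫) (Iio 0) :=
    hws _ (hψ p₀.2)
  -- piece A: change of the test field, uniformly `M`-Lipschitz in `L¹`
  have hA : Tendsto (fun p : ℝ × E => (∫ z, ⟪u p.1 z, ρ.normed volume (p.2 - z) • c⟫) -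
      ∫ z, ⟪u p.1 z, ρ.normed volume (p₀.2 - z) • c⟫) (𝓝[Iio 0 ×ˢ univ] p₀) (𝓝 0) := by
    refine squeeze_zero_norm' (a := fun p : ℝ × E => M * ‖c‖ *
      ∫ z, |ρ.normed volume (p.2 - z) - ρ.normed volume (p₀.2 - z)|) ?_ ?_
    · filter_upwards [self_mem_nhdsWithin] with p hp
      have ht : p.1 < 0 := (mem_prod.1 hp).1
      have i1 := integrable_inner_of_aestronglyMeasurable_of_norm_le (hmeas p.1 ht) (hM p.1 ht) (hψi p.2)
      have i2 := integrable_inner_of_aestronglyMeasurable_of_norm_le (hmeas p.1 ht) (hM p.1 ht) (hψi p₀.2)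
      have idiff : Integrable (fun z => |ρ.normed volume (p.2 - z) - ρ.normed volume (p₀.2 - z)|) volume :=
        ((hfxi p.2).sub (hfxi p₀.2)).abs
      rw [← integral_sub i1 i2, Real.norm_eq_abs]
      calc |∫ z, (⟪u p.1 z, ρ.normed volume (p.2 - z) • c⟫ - ⟪u p.1 z, ρ.normed volume (p₀.2 - z) • c⟫)|
          ≤ ∫ z, ‖⟪u p.1 z, ρ.normed volume (p.2 - z) • c⟫ -
              ⟪u p.1 z, ρ.normed volume (p₀.2 - z) • c⟫‖ := by
            rw [← Real.norm_eq_abs]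
            exact norm_integral_le_integral_norm _
        _ ≤ ∫ z, M * ‖c‖ * |ρ.normed volume (p.2 - z) - ρ.normed volume (p₀.2 - z)| := by
            refine integral_mono_of_nonneg (Eventually.of_forall fun _ => norm_nonneg _)
              (idiff.const_mul (M * ‖c‖)) (Eventually.of_forall fun z => ?_)
            show ‖⟪u p.1 z, ρ.normed volume (p.2 - z) • c⟫ - ⟪u p.1 z, ρ.normed volume (p₀.2 - z) • c⟫‖ ≤
              M * ‖c‖ * |ρ.normed volume (p.2 - z) - ρ.normed volume (p₀.2 - z)|
            rw [← inner_sub_right, ← sub_smul]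
            refine (norm_inner_le_norm _ _).trans ?_
            rw [norm_smul, Real.norm_eq_abs]
            calc ‖u p.1 z‖ * (|ρ.normed volume (p.2 - z) - ρ.normed volume (p₀.2 - z)| * ‖c‖)
                ≤ M * (|ρ.normed volume (p.2 - z) - ρ.normed volume (p₀.2 - z)| * ‖c‖) :=
                  mul_le_mul_of_nonneg_right (hM p.1 ht z) (by positivity)
              _ = M * ‖c‖ * |ρ.normed volume (p.2 - z) - ρ.normed volume (p₀.2 - z)| := by ring
        _ = M * ‖c‖ * ∫ z, |ρ.normed volume (p.2 - z) - ρ.normed volume (p₀.2 - z)| :=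
            integral_const_mul _ _
    · have h : Tendsto (fun p : ℝ × E => M * ‖c‖ *
          ∫ z, |ρ.normed volume (p.2 - z) - ρ.normed volume (p₀.2 - z)|) (𝓝 p₀) (𝓝 0) := by
        have := (hF.comp (continuous_snd.tendsto p₀)).const_mul (M * ‖c‖)
        rwa [mul_zero] at this
      exact h.mono_left nhdsWithin_le_nhds
  -- piece B: change of time at the fixed test field
  have hB : Tendsto (fun p : ℝ × E => (∫ z, ⟪u p.1 z, ρ.normed volume (p₀.2 - z) • c⟫) -
      ∫ z, ⟪u p₀.1 z, ρ.normed volume (p₀.2 - z) • c⟫) (𝓝[Iio 0 ×ˢ univ] p₀) (𝓝 0) := by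
    have hfst : Tendsto (fun p : ℝ × E => p.1) (𝓝[Iio 0 ×ˢ univ] p₀) (𝓝[Iio 0] p₀.1) := by
      refine tendsto_nhdsWithin_iff.2 ⟨?_, ?_⟩
      · exact (continuous_fst.tendsto p₀).mono_left nhdsWithin_le_nhds
      · filter_upwards [self_mem_nhdsWithin] with p hp
        exact (mem_prod.1 hp).1
    have h := ((hg p₀.1 ht₀).tendsto.comp hfst).sub_const
      (∫ z, ⟪u p₀.1 z, ρ.normed volume (p₀.2 - z) • c⟫)
    rw [sub_self] at h
    exact h
  have hsum := (hA.add hB).add_const (∫ z, ⟪u p₀.1 z, ρ.normed volume (p₀.2 - z) • c⟫)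
  rw [add_zero, zero_add] at hsum
  refine hsum.congr fun p => ?_
  ring

/-- **Mollification in space of a weak-* continuous bounded family is jointly continuous.** Let
`u(t) : E → E`, `t < 0`, be bounded by `M` and measurable, and suppose the pairings
`t ↦ ∫⟪u(t), θ⟫` are continuous on `(-∞, 0)` for *every* test field `θ`. Then for a bump `ρ`
the mollified family `(t, x) ↦ (ρ ⋆ u(t))(x)` is jointly continuous on `(-∞, 0) × E`: its
components are pairings `∫⟪u(t), ρ(x - ·) bᵢ⟫` with test fields depending continuously on `x`
in `L¹`, against which `∫⟪u(t), ·⟫` is `M`-Lipschitz uniformly in `t`. [folklore] -/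
theorem continuousOn_convolution_normed (ρ : ContDiffBump (0 : E))
    (hM : ∀ t < 0, ∀ x, ‖u t x‖ ≤ M) (hmeas : ∀ t < 0, AEStronglyMeasurable (u t) volume)
    (hws : ∀ θ : E → E, FunctionSpaces.IsTestFunctionOn (⊤ : Opens E) θ →
      ContinuousOn (fun t => ∫ x, ⟪u t x, θ x⟫) (Iio 0)) :
    ContinuousOn (fun p : ℝ × E => (ρ.normed volume ⋆[lsmul ℝ ℝ, volume] (u p.1)) p.2)
      (Iio 0 ×ˢ univ) := by
  set b := stdOrthonormalBasis ℝ E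
  have hsum : ContinuousOn (fun p : ℝ × E =>
      ∑ i, (∫ z, ⟪u p.1 z, ρ.normed volume (p.2 - z) • b i⟫) • b i) (Iio 0 ×ˢ univ) :=
    continuousOn_finsetSum Finset.univ fun i _ =>
      (continuousOn_integral_inner_normed_smul ρ hM hmeas hws (b i)).smul continuousOn_const
  refine hsum.congr ?_
  rintro ⟨t, x⟩ hp
  have ht : t < 0 := (mem_prod.1 hp).1
  exact convolution_normed_eq_sum_integral_inner ρ (hmeas t ht) (hM t ht) x

end Mollify

/-! ### A jointly measurable modification: the pointwise limit of the mollifications -/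

section Modification

variable {u : ℝ → E → E} {M : ℝ}

/-- **Weak-* continuous bounded families have jointly measurable modifications.** Let
`u(t) : E → E`, `t < 0`, be bounded by `M`, with measurable slices, and weak-* continuous in
time (`t ↦ ∫⟪u(t), θ⟫` continuous on `(-∞, 0)` for every test field `θ`). Then there is a
jointly (strongly) measurable `w : ℝ → E → E` with `w(t) = u(t)` a.e. for **every** `t < 0`:
`w` is the pointwise limit (where it exists, `limUnder`) of the mollifications `ρₙ ⋆ u(t)` for a
mollifier sequence `ρₙ`, which are jointly continuous on `(-∞, 0) × E`
(`continuousOn_convolution_normed`), hence jointly measurable after extension by zero, and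
converge to `u(t)` a.e. on every slice (Lebesgue differentiation). [folklore] -/
theorem exists_stronglyMeasurable_modification
    (hM : ∀ t < 0, ∀ x, ‖u t x‖ ≤ M) (hmeas : ∀ t < 0, AEStronglyMeasurable (u t) volume)
    (hws : ∀ θ : E → E, FunctionSpaces.IsTestFunctionOn (⊤ : Opens E) θ →
      ContinuousOn (fun t => ∫ x, ⟪u t x, θ x⟫) (Iio 0)) :
    ∃ w : ℝ → E → E, StronglyMeasurable (uncurry w) ∧ ∀ t < 0, w t =ᵐ[volume] u t := by
  obtain ⟨φ, hφ, h'φ⟩ := FunctionSpaces.exists_contDiffBump_seq (E := E)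
  set S : Set (ℝ × E) := Iio 0 ×ˢ univ with hS_def
  have hS : MeasurableSet S := measurableSet_Iio.prod MeasurableSet.univ
  -- the mollified families, extended by zero to `t ≥ 0`, are jointly measurable
  have hG : ∀ n, ∃ G : ℝ × E → E, StronglyMeasurable G ∧
      ∀ p : ℝ × E, p.1 < 0 → G p = ((φ n).normed volume ⋆[lsmul ℝ ℝ, volume] (u p.1)) p.2 := by
    intro n
    have hcont := continuousOn_convolution_normed (φ n) hM hmeas hws
    have hc' : Continuous (S.restrict fun p : ℝ × E =>
        ((φ n).normed volume ⋆[lsmul ℝ ℝ, volume] (u p.1)) p.2) :=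
      continuousOn_iff_continuous_restrict.1 hcont
    refine ⟨Function.extend (Subtype.val : S → ℝ × E)
      (S.restrict fun p : ℝ × E => ((φ n).normed volume ⋆[lsmul ℝ ℝ, volume] (u p.1)) p.2)
      (fun _ => 0), (MeasurableEmbedding.subtype_coe hS).stronglyMeasurable_extend
        hc'.stronglyMeasurable stronglyMeasurable_const, fun p hp => ?_⟩
    have hpS : p ∈ S := mem_prod.2 ⟨hp, mem_univ _⟩
    rw [Function.extend_val_apply hpS]
    rfl
  choose G hGm hGval using hG
  -- the pointwise limit
  refine ⟨fun t x => limUnder atTop (fun n => G n (t, x)), ?_, fun t ht => ?_⟩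
  · exact StronglyMeasurable.limUnder (f := fun n p => G n p) hGm
  · have hloc : LocallyIntegrable (u t) volume :=
      (memLp_top_of_bound (hmeas t ht) M (Eventually.of_forall (hM t ht))).locallyIntegrable le_top
    filter_upwards [FunctionSpaces.ae_tendsto_normed_convolution hφ h'φ hloc] with x hx
    have hGx : (fun n => G n (t, x)) = fun n => ((φ n).normed volume ⋆[lsmul ℝ ℝ, volume] (u t)) x :=
      funext fun n => hGval n (t, x) ht
    show limUnder atTop (fun n => G n (t, x)) = u t x
    rw [hGx]
    exact hx.limUnder_eq

end Modification

/-! ### The duality-form fact follows from the printed theorem -/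

section Bridge

/-- **KNSS 2009, Theorem 5.3 as printed implies the duality-form fact `knss_bound_C_over_r`.**
Every family `u` in the hypotheses of the fact — a bounded ancient mild solution in the tree's
duality form (`ν = 1`) with measurable slices, axisymmetric, with `r‖u(t,x)‖ ≤ C` — admits a
jointly measurable modification `w` with `w(t) = u(t)` a.e. for every `t < 0`: its pairings with
divergence-free tests are continuous in time (`AncientMildPairing`), the decay makes it weak-*
continuous against all test fields (`continuousOn_integral_inner_of_cylRadius_decay`), so the
pointwise limit of its spatial mollifications is such a modification
(`exists_stronglyMeasurable_modification`). This discharges the modification hypothesis of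
`knss_bound_C_over_r_of_KNSS2009_of_modification`; together with
`IsBoundedAncientMildSolution.isBoundedWeakNSSolutionOn` (mild ⇒ weak in `L^∞`) the chain is:
printed Theorem 5.3 for the bounded weak solution `w` ⇒ `w(t) = 0` a.e. for a.e. `t` ⇒ every
slice of `u` vanishes a.e. What remains for `knss_bound_C_over_r_holds` is exactly the printed
theorem `KNSS2009_liouville_bound_C_over_r` (KNSS 2009, §4 regularity, Lemma 2.1, Theorem 5.2
and the cut-off argument of p. 10). [cite: KochNadirashviliSereginSverak2009, Thm 5.3 (arXiv p. 10)] -/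
theorem knss_bound_C_over_r_of_KNSS2009 (h53 : KNSS2009_liouville_bound_C_over_r) :
    knss_bound_C_over_r := by
  refine knss_bound_C_over_r_of_KNSS2009_of_modification h53 fun u hu hmeas _ hbound => ?_
  obtain ⟨M, hM'⟩ := hu.2
  have hM : ∀ t < 0, ∀ x, ‖u t x‖ ≤ M := fun t ht x => hM' t ht x
  obtain ⟨C, hC⟩ := hbound
  have hws : ∀ θ : EuclideanSpace ℝ (Fin 3) → EuclideanSpace ℝ (Fin 3),
      FunctionSpaces.IsTestFunctionOn (⊤ : Opens (EuclideanSpace ℝ (Fin 3))) θ →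
      ContinuousOn (fun t => ∫ x, ⟪u t x, θ x⟫) (Iio 0) := fun θ hθ =>
    continuousOn_integral_inner_of_cylRadius_decay hM hmeas hu.1.1
      (fun φ hφ hdiv => hu.continuousOn_integral_inner one_pos hmeas hφ hdiv) hC hθ
  obtain ⟨w, hw, hwu⟩ := exists_stronglyMeasurable_modification hM hmeas hws
  exact ⟨w, hw.aestronglyMeasurable, hwu⟩

end Bridge

end Literature.Analysis.FluidPDE
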